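import Summits.MatrixMultiplication.MatrixMultiplication.Theorems.SaturationLadderPerfectPacking
import Summits.MatrixMultiplication.MatrixMultiplication.Theorems.FarEdgeDescentIsolatedTower
import HarnessLib

/-!
# Route `SaturationLadder` on Strassen's spectrum, XV: THE THIN READING OF THE ISOLATED SQUARING TOWER — every stage an exact roof

decomp-mm lens 1 «grading / quantitative ladder», gen 49, kernel K49-C+ (part 1 of 2; part 2 = `SaturationLadderTowerPlateaux`).
Def-free, sorry-free support module beneath the deciding crux `SubexpSaturation` (stmt-MatrixMultiplication-25909) of
`route-MatrixMultiplication-SaturationLadder`; cut of record UNCHANGED (`closes (h₁ : SubexpSaturation) (h₂ : SubexpToPoly)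
(h₃ : PolyToFinite) (h₄ : TailDescentTwo) (h₅ : SquareFromTwo)`).  `θ = specMMPoint K φ`, `εᵢ = 1 − θᵢ`.

THE OBSERVATION (memo NODE-SaturationLadder-g49 §2).  Route `FarEdgeDescent`'s certified improvable squaring tower
(kernels XXXII-B/C `isolated_stage`, `isolatedTowerChain`) started from an isolated-anchor realization of
`⟨1,Q₀,1⟩ ⊕ ⊕ᵢ⟨aᵢ,bᵢ,aᵢ⟩` of length `r₀ = Q₀ + 2∑aᵢbᵢ` that is OUTPUT-PERFECT (`r₀ = 1 + ∑aᵢ² = W₀`, the number of output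
entries) STAYS OUTPUT-PERFECT AT EVERY STAGE: the stage map squares the length (`r' = r²`) and squares the output count
(`W' = 1 + ∑_{kept pairs}(aa')² = (∑a²)²`, the drop-anchor counting identity `keptPairSquares_eq`).  Hence (K48-P,
Coppersmith's type selection in spectral form, `weightedRoof_of_perfectReadout`) EVERY stage `j` is an exact thin roof
over every field,  `B_j·θ₁ ≤ A_j·(ε₀ + ε₂)`  (`⟺ ω_K(1, B_j/A_j, 1) = 2`, part 2), with the SHAPE SUMS `A = ∑ k²log k`,
`B = ∑ k² log m` obeying the exact linear recursion (polarised counting identity `sum_pairDrop_polar`)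
`A_{j+1} = 2r_jA_j`, `B_{j+1} = 2r_jB_j − 2 log Q_j + log Q_{j+1}` next to `Q + 2L = r`, `L' = (Q+L)² − Q²`, `r' = r²`,
`Q' = r' − 2L'` — only the five number sequences are exported (`thinTowerChain`); route `FarEdgeDescent`'s exported
readout `G_j ≤ r_j` drops the anchor and could not see this (its certificates are not perfect).
* §1 counting identities over the drop-anchor enumeration of pairs (`sum_pairDrop_polar`, `cast_mul_mul_log_mul`);
* §2 the thin recursion (`thinChain_exists`) and the stage bookkeeping of an anchored family (`keptPairSquares_eq`,
  `keptPairALog_eq`, `keptPairBLog_eq`);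
* §3 `thinTowerChain`.
Tags: `SubexpSaturation` (h₁) NEC-side ladder · WEAKER · ATTACKED.  No defs.
[cite: Schonhage1981, §5] [cite: Pan1984, Props. 16.2–16.5] [cite: Coppersmith1982, Theorem (BCS 1997 Thm. (15.51))]
[cite: Stothers2010, §1, Thm. 8] [cite: Strassen1988, Thm. 3.8] [cite: KnuthTAOCP2, §4.6.4, Ex. 67(g),(h)]
-/

set_option linter.dupNamespace false

noncomputable section

open scoped BigOperators Polynomial
open Polynomial

namespace Summit.MatrixMultiplication.MatrixMultiplication.Theorems.SaturationLadderTowerChain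

open Literature.Computability.AlgebraicComplexity
open Summit.MatrixMultiplication.MatrixMultiplication.Theorems.FarEdgeDescentIsolatedStep
open Summit.MatrixMultiplication.MatrixMultiplication.Theorems.FarEdgeDescentIsolatedSquare
open Summit.MatrixMultiplication.MatrixMultiplication.Theorems.FarEdgeDescentIsolatedChain
open Summit.MatrixMultiplication.MatrixMultiplication.Theorems.FarEdgeDescentTowerChain
open Summit.MatrixMultiplication.MatrixMultiplication.Theorems.SaturationLadderPerfectPacking

/-! ## §1 Counting identities over the drop-anchor enumeration of pairs -/

/-- Kernel XXXII-B's counting identity `f(i₀)² + ∑_{kept pairs} f(w₁)f(w₂) = (∑f)²`, for a NAMED enumeration `φ`. [folklore] -/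
theorem sum_pairDrop_add' {S : Type*} [CommSemiring S] {P : ℕ} (f : Fin P → S) {M : ℕ}
    (hM : P * P = M + 1) (i₀ : Fin P) (φ : Fin M → Fin P × Fin P)
    (hφ : φ = fun w => finProdFinEquiv.symm (Fin.cast hM.symm
      ((Fin.cast hM (finProdFinEquiv (i₀, i₀))).succAbove w))) :
    f i₀ * f i₀ + ∑ w, f (φ w).1 * f (φ w).2 = (∑ i, f i) ^ 2 := by
  subst hφ
  exact sum_pairDrop_add f hM i₀

/-- **Polarised drop-anchor identity**: `∑_{kept pairs} (f(w₁)g(w₂) + g(w₁)f(w₂)) = 2(∑f)(∑g) − 2f(i₀)g(i₀)`. [folklore] -/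
theorem sum_pairDrop_polar {S : Type*} [CommRing S] {P : ℕ} (f g : Fin P → S) {M : ℕ}
    (hM : P * P = M + 1) (i₀ : Fin P) (φ : Fin M → Fin P × Fin P)
    (hφ : φ = fun w => finProdFinEquiv.symm (Fin.cast hM.symm
      ((Fin.cast hM (finProdFinEquiv (i₀, i₀))).succAbove w))) :
    (∑ w, (f (φ w).1 * g (φ w).2 + g (φ w).1 * f (φ w).2)) =
      2 * ((∑ i, f i) * ∑ i, g i) - 2 * (f i₀ * g i₀) := by
  have h1 := sum_pairDrop_add' (fun i => f i + g i) hM i₀ φ hφ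
  have h2 := sum_pairDrop_add' f hM i₀ φ hφ
  have h3 := sum_pairDrop_add' g hM i₀ φ hφ
  simp only [Finset.sum_add_distrib] at h1
  have h4 : (∑ w, (f (φ w).1 + g (φ w).1) * (f (φ w).2 + g (φ w).2)) =
      (∑ w, f (φ w).1 * f (φ w).2) + (∑ w, g (φ w).1 * g (φ w).2) +
        ∑ w, (f (φ w).1 * g (φ w).2 + g (φ w).1 * f (φ w).2) := by
    rw [← Finset.sum_add_distrib, ← Finset.sum_add_distrib]
    exact Finset.sum_congr rfl fun w _ => by ring
  linear_combination h1 - h2 - h3 - h4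

/-- **Log-shape of a product block**: `(xy)² log(z₁z₂) = (x² log z₁)·y² + x²·(y² log z₂)` (casts from `ℕ`). [folklore] -/
theorem cast_mul_mul_log_mul {x y z₁ z₂ : ℕ} (hz₁ : 1 ≤ z₁) (hz₂ : 1 ≤ z₂) :
    (((x * y : ℕ) : ℕ) : ℝ) * ((x * y : ℕ) : ℝ) * Real.log ((z₁ * z₂ : ℕ) : ℝ) =
      ((x : ℝ) * x * Real.log z₁) * ((y : ℝ) * y) + ((x : ℝ) * x) * ((y : ℝ) * y * Real.log z₂) := by
  have h1 : ((z₁ : ℕ) : ℝ) ≠ 0 := by exact_mod_cast (show z₁ ≠ 0 by omega)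
  have h2 : ((z₂ : ℕ) : ℝ) ≠ 0 := by exact_mod_cast (show z₂ ≠ 0 by omega)
  push_cast
  rw [Real.log_mul h1 h2]
  ring

/-! ## §2 The thin numeric recursion (constructed, not defined) and the stage bookkeeping of an anchored family -/

/-- **The thin recursion of the improvable squaring tower exists** (primitive recursion on a quintuple):
`L' = (Q+L)² − Q²`, `r' = r²`, `Q' = r² − 2L'`, `A' = 2rA`, `B' = 2rB − 2 log Q + log Q'`. [folklore] -/
theorem thinChain_exists (r₀ Q₀ L₀ : ℕ) (A₀ B₀ : ℝ) :
    ∃ (r Q L : ℕ → ℕ) (A B : ℕ → ℝ),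
      r 0 = r₀ ∧ Q 0 = Q₀ ∧ L 0 = L₀ ∧ A 0 = A₀ ∧ B 0 = B₀ ∧
      (∀ j, L (j + 1) = (Q j + L j) ^ 2 - Q j ^ 2) ∧
      (∀ j, r (j + 1) = r j ^ 2) ∧
      (∀ j, Q (j + 1) = r j ^ 2 - 2 * L (j + 1)) ∧
      (∀ j, A (j + 1) = 2 * (r j : ℝ) * A j) ∧
      (∀ j, B (j + 1) = 2 * (r j : ℝ) * B j - 2 * Real.log (Q j) + Real.log (Q (j + 1))) := by
  let step : (ℕ × ℕ × ℕ) × (ℝ × ℝ) → (ℕ × ℕ × ℕ) × (ℝ × ℝ) := fun x =>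
    ((x.1.1 ^ 2,
      x.1.1 ^ 2 - 2 * ((x.1.2.1 + x.1.2.2) ^ 2 - x.1.2.1 ^ 2),
      (x.1.2.1 + x.1.2.2) ^ 2 - x.1.2.1 ^ 2),
      (2 * (x.1.1 : ℝ) * x.2.1,
        2 * (x.1.1 : ℝ) * x.2.2 - 2 * Real.log (x.1.2.1 : ℝ) +
          Real.log (((x.1.1 ^ 2 - 2 * ((x.1.2.1 + x.1.2.2) ^ 2 - x.1.2.1 ^ 2) : ℕ) : ℝ))))
  let U : ℕ → (ℕ × ℕ × ℕ) × (ℝ × ℝ) := fun j =>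
    Nat.rec (motive := fun _ => (ℕ × ℕ × ℕ) × (ℝ × ℝ)) ((r₀, Q₀, L₀), (A₀, B₀)) (fun _ x => step x) j
  have hU : ∀ j, U (j + 1) = step (U j) := fun j => rfl
  refine ⟨fun j => (U j).1.1, fun j => (U j).1.2.1, fun j => (U j).1.2.2, fun j => (U j).2.1,
    fun j => (U j).2.2, rfl, rfl, rfl, rfl, rfl, fun j => ?_, fun j => ?_, fun j => ?_, fun j => ?_,
    fun j => ?_⟩ <;>
  simp only [hU, step]

section Anchored

variable {p : ℕ} (a b : Fin p → ℕ) (q : ℕ) {M : ℕ} (hM : (p + 1) * (p + 1) = M + 1)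
  (φ : Fin M → Fin (p + 1) × Fin (p + 1))
  (hφ : φ = fun w => finProdFinEquiv.symm (Fin.cast hM.symm
    ((Fin.cast hM (finProdFinEquiv ((0 : Fin (p + 1)), (0 : Fin (p + 1))))).succAbove w)))

include hφ

/-- Kernel XXXII-C's `keptPairLegs_eq` for a NAMED enumeration: `∑_{kept} (a a')(b b') = (q + ∑ ab)² − q²`. [folklore] -/
theorem keptPairLegs_eq' :
    (∑ w, ((Fin.cons 1 a : Fin (p + 1) → ℕ) (φ w).1 * (Fin.cons 1 a : Fin (p + 1) → ℕ) (φ w).2) *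
        ((Fin.cons q b : Fin (p + 1) → ℕ) (φ w).1 * (Fin.cons q b : Fin (p + 1) → ℕ) (φ w).2)) =
      (q + ∑ i, a i * b i) ^ 2 - q ^ 2 := by
  subst hφ
  exact keptPairLegs_eq a b q hM

/-- **Output counts of the kept pairs**: `∑_{new family} k'² = (∑ k²)²` for the squared anchored family
`⟨1,q',1⟩ ⊕ ⊕_{kept (w₁,w₂)} ⟨k_{w₁}k_{w₂}, m_{w₁}m_{w₂}, k_{w₁}k_{w₂}⟩` — OUTPUT-PERFECTNESS SQUARES. [folklore] -/
theorem keptPairSquares_eq :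
    (∑ i, (Fin.cons 1 (fun w => (Fin.cons 1 a : Fin (p + 1) → ℕ) (φ w).1 *
        (Fin.cons 1 a : Fin (p + 1) → ℕ) (φ w).2) : Fin (M + 1) → ℕ) i *
      (Fin.cons 1 (fun w => (Fin.cons 1 a : Fin (p + 1) → ℕ) (φ w).1 *
        (Fin.cons 1 a : Fin (p + 1) → ℕ) (φ w).2) : Fin (M + 1) → ℕ) i) =
      (∑ i, (Fin.cons 1 a : Fin (p + 1) → ℕ) i * (Fin.cons 1 a : Fin (p + 1) → ℕ) i) ^ 2 := by
  have h := sum_pairDrop_add'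
    (fun i : Fin (p + 1) => (Fin.cons 1 a : Fin (p + 1) → ℕ) i * (Fin.cons 1 a : Fin (p + 1) → ℕ) i)
    hM (0 : Fin (p + 1)) φ hφ
  simp only [Fin.cons_zero, mul_one] at h
  rw [Fin.sum_univ_succ]
  simp only [Fin.cons_zero, Fin.cons_succ, mul_one]
  rw [← h]
  congr 1
  exact Finset.sum_congr rfl fun w _ => by ring

/-- **`A`-shape of the kept pairs**: `∑_{new} k'² log k' = 2·(∑k²)·(∑ k² log k)` (anchor `k₀ = 1` contributes `0`). [folklore] -/
theorem keptPairALog_eq (ha : ∀ i, 2 ≤ a i) :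
    (∑ i, (((Fin.cons 1 (fun w => (Fin.cons 1 a : Fin (p + 1) → ℕ) (φ w).1 *
        (Fin.cons 1 a : Fin (p + 1) → ℕ) (φ w).2) : Fin (M + 1) → ℕ) i : ℕ) : ℝ) *
      (Fin.cons 1 (fun w => (Fin.cons 1 a : Fin (p + 1) → ℕ) (φ w).1 *
        (Fin.cons 1 a : Fin (p + 1) → ℕ) (φ w).2) : Fin (M + 1) → ℕ) i *
      Real.log ((Fin.cons 1 (fun w => (Fin.cons 1 a : Fin (p + 1) → ℕ) (φ w).1 *
        (Fin.cons 1 a : Fin (p + 1) → ℕ) (φ w).2) : Fin (M + 1) → ℕ) i)) =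
      2 * (∑ i, (((Fin.cons 1 a : Fin (p + 1) → ℕ) i : ℕ) : ℝ) * (Fin.cons 1 a : Fin (p + 1) → ℕ) i) *
        ∑ i, (((Fin.cons 1 a : Fin (p + 1) → ℕ) i : ℕ) : ℝ) * (Fin.cons 1 a : Fin (p + 1) → ℕ) i *
          Real.log ((Fin.cons 1 a : Fin (p + 1) → ℕ) i) := by
  have h1 := cons_one_le a ha
  have hterm : ∀ w,
      ((((Fin.cons 1 a : Fin (p + 1) → ℕ) (φ w).1 * (Fin.cons 1 a : Fin (p + 1) → ℕ) (φ w).2 : ℕ) : ℕ) : ℝ) *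
        (((Fin.cons 1 a : Fin (p + 1) → ℕ) (φ w).1 * (Fin.cons 1 a : Fin (p + 1) → ℕ) (φ w).2 : ℕ) : ℝ) *
        Real.log (((Fin.cons 1 a : Fin (p + 1) → ℕ) (φ w).1 * (Fin.cons 1 a : Fin (p + 1) → ℕ) (φ w).2 : ℕ) : ℝ) =
      ((((Fin.cons 1 a : Fin (p + 1) → ℕ) (φ w).1 : ℕ) : ℝ) * (Fin.cons 1 a : Fin (p + 1) → ℕ) (φ w).1 *
          Real.log ((Fin.cons 1 a : Fin (p + 1) → ℕ) (φ w).1)) *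
        ((((Fin.cons 1 a : Fin (p + 1) → ℕ) (φ w).2 : ℕ) : ℝ) * (Fin.cons 1 a : Fin (p + 1) → ℕ) (φ w).2) +
      ((((Fin.cons 1 a : Fin (p + 1) → ℕ) (φ w).1 : ℕ) : ℝ) * (Fin.cons 1 a : Fin (p + 1) → ℕ) (φ w).1) *
        ((((Fin.cons 1 a : Fin (p + 1) → ℕ) (φ w).2 : ℕ) : ℝ) * (Fin.cons 1 a : Fin (p + 1) → ℕ) (φ w).2 *
          Real.log ((Fin.cons 1 a : Fin (p + 1) → ℕ) (φ w).2)) :=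
    fun w => cast_mul_mul_log_mul (h1 _) (h1 _)
  have hpol := sum_pairDrop_polar
    (fun i => (((Fin.cons 1 a : Fin (p + 1) → ℕ) i : ℕ) : ℝ) * (Fin.cons 1 a : Fin (p + 1) → ℕ) i *
      Real.log ((Fin.cons 1 a : Fin (p + 1) → ℕ) i))
    (fun i => (((Fin.cons 1 a : Fin (p + 1) → ℕ) i : ℕ) : ℝ) * (Fin.cons 1 a : Fin (p + 1) → ℕ) i) hM 0 φ hφ
  simp only [Fin.cons_zero, Nat.cast_one, Real.log_one, mul_zero, mul_one, sub_zero] at hpol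
  rw [Fin.sum_univ_succ]
  simp only [Fin.cons_zero, Fin.cons_succ, Nat.cast_one, Real.log_one, mul_zero, zero_add]
  rw [Finset.sum_congr rfl fun w _ => hterm w, hpol]
  ring

/-- **`B`-shape of the kept pairs**: `∑_{new} k'² log m' = log q' + 2·(∑k²)·(∑ k² log m) − 2 log q`
(the old anchor `⟨1,q,1⟩` contributed `log q`, the new one contributes `log q'`). [folklore] -/
theorem keptPairBLog_eq (hb : ∀ i, 1 ≤ b i) (hq : 1 ≤ q) (q' : ℕ) :
    (∑ i, (((Fin.cons 1 (fun w => (Fin.cons 1 a : Fin (p + 1) → ℕ) (φ w).1 *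
        (Fin.cons 1 a : Fin (p + 1) → ℕ) (φ w).2) : Fin (M + 1) → ℕ) i : ℕ) : ℝ) *
      (Fin.cons 1 (fun w => (Fin.cons 1 a : Fin (p + 1) → ℕ) (φ w).1 *
        (Fin.cons 1 a : Fin (p + 1) → ℕ) (φ w).2) : Fin (M + 1) → ℕ) i *
      Real.log ((Fin.cons q' (fun w => (Fin.cons q b : Fin (p + 1) → ℕ) (φ w).1 *
        (Fin.cons q b : Fin (p + 1) → ℕ) (φ w).2) : Fin (M + 1) → ℕ) i)) =
      Real.log q' +
        (2 * (∑ i, (((Fin.cons 1 a : Fin (p + 1) → ℕ) i : ℕ) : ℝ) * (Fin.cons 1 a : Fin (p + 1) → ℕ) i) *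
          ∑ i, (((Fin.cons 1 a : Fin (p + 1) → ℕ) i : ℕ) : ℝ) * (Fin.cons 1 a : Fin (p + 1) → ℕ) i *
            Real.log ((Fin.cons q b : Fin (p + 1) → ℕ) i) - 2 * Real.log q) := by
  have h1 := cons_mid_one_le b q hb hq
  have hterm : ∀ w,
      ((((Fin.cons 1 a : Fin (p + 1) → ℕ) (φ w).1 * (Fin.cons 1 a : Fin (p + 1) → ℕ) (φ w).2 : ℕ) : ℕ) : ℝ) *
        (((Fin.cons 1 a : Fin (p + 1) → ℕ) (φ w).1 * (Fin.cons 1 a : Fin (p + 1) → ℕ) (φ w).2 : ℕ) : ℝ) *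
        Real.log (((Fin.cons q b : Fin (p + 1) → ℕ) (φ w).1 * (Fin.cons q b : Fin (p + 1) → ℕ) (φ w).2 : ℕ) : ℝ) =
      ((((Fin.cons 1 a : Fin (p + 1) → ℕ) (φ w).1 : ℕ) : ℝ) * (Fin.cons 1 a : Fin (p + 1) → ℕ) (φ w).1 *
          Real.log ((Fin.cons q b : Fin (p + 1) → ℕ) (φ w).1)) *
        ((((Fin.cons 1 a : Fin (p + 1) → ℕ) (φ w).2 : ℕ) : ℝ) * (Fin.cons 1 a : Fin (p + 1) → ℕ) (φ w).2) +
      ((((Fin.cons 1 a : Fin (p + 1) → ℕ) (φ w).1 : ℕ) : ℝ) * (Fin.cons 1 a : Fin (p + 1) → ℕ) (φ w).1) *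
        ((((Fin.cons 1 a : Fin (p + 1) → ℕ) (φ w).2 : ℕ) : ℝ) * (Fin.cons 1 a : Fin (p + 1) → ℕ) (φ w).2 *
          Real.log ((Fin.cons q b : Fin (p + 1) → ℕ) (φ w).2)) :=
    fun w => cast_mul_mul_log_mul (h1 _) (h1 _)
  have hpol := sum_pairDrop_polar
    (fun i => (((Fin.cons 1 a : Fin (p + 1) → ℕ) i : ℕ) : ℝ) * (Fin.cons 1 a : Fin (p + 1) → ℕ) i *
      Real.log ((Fin.cons q b : Fin (p + 1) → ℕ) i))
    (fun i => (((Fin.cons 1 a : Fin (p + 1) → ℕ) i : ℕ) : ℝ) * (Fin.cons 1 a : Fin (p + 1) → ℕ) i) hM 0 φ hφ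
  simp only [Fin.cons_zero, Nat.cast_one, mul_one, one_mul] at hpol
  rw [Fin.sum_univ_succ]
  simp only [Fin.cons_zero, Fin.cons_succ, Nat.cast_one, one_mul]
  rw [Finset.sum_congr rfl fun w _ => hterm w, hpol]
  ring

end Anchored

/-! ## §3 The thin tower: every stage an output-perfect isolated certificate, every stage an exact roof -/

variable (K : Type) [Field K]

/-- **THE THIN READING OF THE ISOLATED SQUARING TOWER.**  From an isolated-anchor approximate realization of
`⟨1,Q₀,1⟩ ⊕ ⊕ᵢ⟨aᵢ,bᵢ,aᵢ⟩` (`aᵢ ≥ 2`, `bᵢ ≥ 1`, `Q₀ ≥ 1`) of length `r₀ = Q₀ + 2∑aᵢbᵢ` that is OUTPUT-PERFECT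
(`1 + ∑aᵢ² = r₀`): sequences `r, Q, L` (route `FarEdgeDescent`'s clock-`2` improvable recursion, kernel XXXII-C) and the
SHAPE SUMS `A, B` with `A₀ = ∑aᵢ²log aᵢ`, `B₀ = log Q₀ + ∑aᵢ²log bᵢ`, `A' = 2rA`, `B' = 2rB − 2log Q + log Q'`, `B ≥ 0`, such that
EVERY stage is an exact thin roof over `K`: `B_j·θ₁ ≤ A_j·(ε₀ + ε₂)` for every universal spectral point — each stage is
realised by an actual isolated-anchor algorithm (XXXII-B `isolated_stage`) whose length EQUALS its number of output entries,
and K48-P `weightedRoof_of_perfectReadout` reads the roof off it.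
[cite: Pan1984, Props. 16.2–16.5] [cite: Schonhage1981, §5] [cite: Coppersmith1982, Theorem (BCS 1997 Thm. (15.51))]
[cite: Stothers2010, §1, Thm. 8] [cite: Strassen1988, Thm. 3.8] -/
theorem thinTowerChain {p₀ : ℕ} (a₀ b₀ : Fin p₀ → ℕ) (ha₀ : ∀ i, 2 ≤ a₀ i) (hb₀ : ∀ i, 1 ≤ b₀ i)
    {Q₀ r₀ h₀ : ℕ} (hQ₀ : 1 ≤ Q₀) (hsum₀ : Q₀ + 2 * ∑ i, a₀ i * b₀ i = r₀)
    (hW₀ : 1 + ∑ i, a₀ i * a₀ i = r₀)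
    (hinv₀ : ∃ (u : Fin r₀ → _ → K[X]) (v : Fin r₀ → _ → K[X]) (w : Fin r₀ → _ → K[X])
      (d : Fin r₀ → K[X]),
      IsApproxDecomposition h₀ (matMulDirectSum K (Fin.cons 1 a₀) (Fin.cons Q₀ b₀) (Fin.cons 1 a₀))
        u v w ∧ (∀ s, d s ≠ 0) ∧ ∀ b c, ¬ (b.1 = 0 ∧ c.1 = 0) → ∑ s, d s * v s b * w s c = 0) :
    ∃ (r Q L : ℕ → ℕ) (A B : ℕ → ℝ),
      r 0 = r₀ ∧ Q 0 = Q₀ ∧ L 0 = ∑ i, a₀ i * b₀ i ∧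
      A 0 = ∑ i, ((a₀ i : ℕ) : ℝ) * a₀ i * Real.log (a₀ i) ∧
      B 0 = Real.log Q₀ + ∑ i, ((a₀ i : ℕ) : ℝ) * a₀ i * Real.log (b₀ i) ∧
      (∀ j, Q j + 2 * L j = r j) ∧ (∀ j, 1 ≤ Q j) ∧
      (∀ j, L (j + 1) = (Q j + L j) ^ 2 - Q j ^ 2) ∧
      (∀ j, r (j + 1) = r j ^ 2) ∧
      (∀ j, A (j + 1) = 2 * (r j : ℝ) * A j) ∧
      (∀ j, B (j + 1) = 2 * (r j : ℝ) * B j - 2 * Real.log (Q j) + Real.log (Q (j + 1))) ∧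
      (∀ j, 0 ≤ B j) ∧
      (∀ j (F : SpectralMap K), IsUniversalSpectralPoint K F →
        B j * specMMPoint K F 1 ≤ A j * ((1 - specMMPoint K F 0) + (1 - specMMPoint K F 2))) := by
  classical
  obtain ⟨r, Q, L, A, B, h0r, h0Q, h0L, h0A, h0B, hL, hr, hQ, hA, hB⟩ :=
    thinChain_exists r₀ Q₀ (∑ i, a₀ i * b₀ i) (∑ i, ((a₀ i : ℕ) : ℝ) * a₀ i * Real.log (a₀ i))
      (Real.log Q₀ + ∑ i, ((a₀ i : ℕ) : ℝ) * a₀ i * Real.log (b₀ i))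
  -- the invariant: stage `j` is an OUTPUT-PERFECT isolated-anchor algorithm with the recorded numbers
  have key : ∀ j, ∃ (p : ℕ) (a b : Fin p → ℕ) (q ϱ : ℕ), q = Q j ∧ ϱ = r j ∧ (∀ i, 2 ≤ a i) ∧
      (∀ i, 1 ≤ b i) ∧ 1 ≤ q ∧ q + 2 * (∑ i, a i * b i) = ϱ ∧ (∑ i, a i * b i) = L j ∧
      (∑ i, (Fin.cons 1 a : Fin (p + 1) → ℕ) i * (Fin.cons 1 a : Fin (p + 1) → ℕ) i) = ϱ ∧
      (∑ i, (((Fin.cons 1 a : Fin (p + 1) → ℕ) i : ℕ) : ℝ) * (Fin.cons 1 a : Fin (p + 1) → ℕ) i *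
          Real.log ((Fin.cons 1 a : Fin (p + 1) → ℕ) i)) = A j ∧
      (∑ i, (((Fin.cons 1 a : Fin (p + 1) → ℕ) i : ℕ) : ℝ) * (Fin.cons 1 a : Fin (p + 1) → ℕ) i *
          Real.log ((Fin.cons q b : Fin (p + 1) → ℕ) i)) = B j ∧
      ∃ (h : ℕ) (u : Fin ϱ → _ → K[X]) (v : Fin ϱ → _ → K[X]) (w : Fin ϱ → _ → K[X])
        (d : Fin ϱ → K[X]),
        IsApproxDecomposition h (matMulDirectSum K (Fin.cons 1 a) (Fin.cons q b) (Fin.cons 1 a))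
          u v w ∧ (∀ s, d s ≠ 0) ∧ ∀ b c, ¬ (b.1 = 0 ∧ c.1 = 0) → ∑ s, d s * v s b * w s c = 0 := by
    intro j
    induction j with
    | zero =>
      refine ⟨p₀, a₀, b₀, Q₀, r₀, h0Q.symm, h0r.symm, ha₀, hb₀, hQ₀, hsum₀, h0L.symm, ?_, ?_, ?_, h₀,
        hinv₀⟩
      · rw [Fin.sum_univ_succ]
        simpa using hW₀
      · rw [h0A, Fin.sum_univ_succ]
        simp
      · rw [h0B, Fin.sum_univ_succ]
        simp
    | succ j ih =>
      obtain ⟨p, a, b, q, ϱ, hq, hϱ, ha, hb, hq1, hsum, hLj, hW, hAj, hBj, h, hinv⟩ := ih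
      obtain ⟨M, hM⟩ : ∃ M, (p + 1) * (p + 1) = M + 1 :=
        ⟨(p + 1) * (p + 1) - 1, (Nat.succ_pred_eq_of_pos (Nat.mul_pos p.succ_pos p.succ_pos)).symm⟩
      obtain ⟨φ, hφ⟩ : ∃ φ : Fin M → Fin (p + 1) × Fin (p + 1), φ = fun w => finProdFinEquiv.symm
          (Fin.cast hM.symm ((Fin.cast hM (finProdFinEquiv ((0 : Fin (p + 1)), (0 : Fin (p + 1))))).succAbove w)) :=
        ⟨_, rfl⟩
      have hφinj : Function.Injective φ := by subst hφ; exact pairDrop_injective hM _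
      have hφ₀ : ∀ w, φ w ≠ (0, 0) := by subst hφ; exact pairDrop_ne hM 0
      have hlegs := keptPairLegs_eq' a b q hM φ hφ
      have hexp : (q + ∑ i, a i * b i) ^ 2 - q ^ 2 =
          2 * q * (∑ i, a i * b i) + (∑ i, a i * b i) ^ 2 := by
        apply Nat.sub_eq_of_eq_add
        ring
      have hϱsq : ϱ * ϱ = 2 * ((q + ∑ i, a i * b i) ^ 2 - q ^ 2) + (q ^ 2 + 2 * (∑ i, a i * b i) ^ 2) := by
        rw [hexp, ← hsum]
        ring
      have h2L : 2 * ((q + ∑ i, a i * b i) ^ 2 - q ^ 2) ≤ ϱ * ϱ := by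
        rw [hϱsq]
        exact Nat.le_add_right _ _
      have hq'1 : 1 ≤ ϱ * ϱ - 2 * ((q + ∑ i, a i * b i) ^ 2 - q ^ 2) := by
        rw [hϱsq, Nat.add_sub_cancel_left]
        nlinarith
      have hQ' : ϱ * ϱ - 2 * ((q + ∑ i, a i * b i) ^ 2 - q ^ 2) = Q (j + 1) := by
        rw [hQ, hL, ← hq, ← hLj, ← hϱ, sq ϱ]
      have hr' : ϱ * ϱ = r (j + 1) := by rw [hr, ← hϱ, sq ϱ]
      have st := isolated_stage K (Fin.cons 1 a) (Fin.cons q b) (Fin.cons 1 a) hinv φ hφinj hφ₀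
        (q := ϱ * ϱ - 2 * ((q + ∑ i, a i * b i) ^ 2 - q ^ 2)) (by
          have hY : (∑ w, ((Fin.cons q b : Fin (p + 1) → ℕ) (φ w).1 * (Fin.cons q b : Fin (p + 1) → ℕ) (φ w).2) *
              ((Fin.cons 1 a : Fin (p + 1) → ℕ) (φ w).1 * (Fin.cons 1 a : Fin (p + 1) → ℕ) (φ w).2)) =
              (q + ∑ i, a i * b i) ^ 2 - q ^ 2 := by
            rw [← hlegs]
            exact Finset.sum_congr rfl fun w _ => mul_comm _ _
          rw [hlegs, hY]
          omega)
      have hWr : (∑ i, (((Fin.cons 1 a : Fin (p + 1) → ℕ) i : ℕ) : ℝ) *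
          (Fin.cons 1 a : Fin (p + 1) → ℕ) i) = ϱ := by
        exact_mod_cast hW
      refine ⟨M, _, _, ϱ * ϱ - 2 * ((q + ∑ i, a i * b i) ^ 2 - q ^ 2), ϱ * ϱ, hQ', hr',
        fun w => two_le_mul_of_ne_anchorPair (Fin.cons 1 a) (cons_one_le a ha) (cons_two_le a ha) (hφ₀ w),
        fun w => one_le_mul_of_one_le (Fin.cons q b) (cons_mid_one_le b q hb hq1) _, hq'1, ?_, ?_,
        ?_, ?_, ?_, st⟩
      · -- tightness `q' + 2L' = r'`
        rw [hlegs]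
        omega
      · -- legs
        rw [hlegs, hL, ← hq, ← hLj]
      · -- output-perfectness squares: `W' = W² = r'`
        rw [keptPairSquares_eq a hM φ hφ, hW, sq]
      · -- `A' = 2 r A`
        rw [keptPairALog_eq a hM φ hφ ha, hWr, hAj, hA, hϱ]
      · -- `B' = log Q' + 2 r B − 2 log Q`
        rw [keptPairBLog_eq a b q hM φ hφ hb hq1, hWr, hBj, hB, ← hQ', ← hq, ← hϱ]
        ring
  refine ⟨r, Q, L, A, B, h0r, h0Q, h0L, h0A, h0B, fun j => ?_, fun j => ?_, hL, hr, hA, hB,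
    fun j => ?_, fun j F hF => ?_⟩
  · obtain ⟨p, a, b, q, ϱ, hq, hϱ, -, -, -, hsum, hLj, -⟩ := key j
    rw [← hq, ← hϱ, ← hLj]
    exact hsum
  · obtain ⟨p, a, b, q, ϱ, hq, -, -, -, hq1, -⟩ := key j
    rw [← hq]
    exact hq1
  · obtain ⟨p, a, b, q, ϱ, -, -, -, hb, hq1, -, -, -, -, hBj, -⟩ := key j
    rw [← hBj]
    exact shapeSum_nonneg (Fin.cons q b) (cons_mid_one_le b q hb hq1)
  · obtain ⟨p, a, b, q, ϱ, hq, hϱ, ha, hb, hq1, hsum, hLj, hW, hAj, hBj, h, hinv⟩ := key j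
    have hbr := algBorderRank_le_of_isolated K hinv
    have hpos : ∀ i, 1 ≤ (Fin.cons 1 a : Fin (p + 1) → ℕ) i ∧ 1 ≤ (Fin.cons q b : Fin (p + 1) → ℕ) i ∧
        1 ≤ (Fin.cons 1 a : Fin (p + 1) → ℕ) i :=
      fun i => ⟨cons_one_le a ha i, cons_mid_one_le b q hb hq1 i, cons_one_le a ha i⟩
    have hWr : (∑ i, (((Fin.cons 1 a : Fin (p + 1) → ℕ) i : ℕ) : ℝ) *
        (Fin.cons 1 a : Fin (p + 1) → ℕ) i) = ϱ := by
      exact_mod_cast hW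
    have hread : ∀ G : SpectralMap K, IsUniversalSpectralPoint K G →
        ∑ i, G (matMulTensor K ((Fin.cons 1 a : Fin (p + 1) → ℕ) i) ((Fin.cons q b : Fin (p + 1) → ℕ) i)
          ((Fin.cons 1 a : Fin (p + 1) → ℕ) i)) ≤
          ∑ i, (((Fin.cons 1 a : Fin (p + 1) → ℕ) i : ℕ) : ℝ) * (Fin.cons 1 a : Fin (p + 1) → ℕ) i := by
      intro G hG
      rw [hWr]
      exact sum_map_le_of_algBorderRank_le hG _ _ _ hbr
    have hroof := weightedRoof_of_perfectReadout hpos (Nat.succ_pos p) hread hF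
    rw [hAj, hBj] at hroof
    linarith

end Summit.MatrixMultiplication.MatrixMultiplication.Theorems.SaturationLadderTowerChain

end
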